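import Literature.AnabelianGeometry.EtaleTheta.ArithThetaTowerFrobenioid
import Literature.AnabelianGeometry.EtaleTheta.ArithThetaTowerRealifiedOf
import Literature.AnabelianGeometry.EtaleTheta.TemperedFrobenioidLaws
import Literature.AnabelianGeometry.EtaleTheta.Discharge.Sec3Thm37UnitsTreeMonoidVocabWeak
import Literature.AnabelianGeometry.EtaleTheta.Discharge.Sec3PhiRIntegralWeak
import Literature.AnabelianGeometry.SemiGraphs.CosetCategoriesFSM
import HarnessLib

/-!
# [IUTchI] Ex. 3.2 (i) / [EtTh] Def. 3.6 (ii) at the ARITHMETIC theta tower over `𝒟_v̲ = CosetCat Π_v̲`: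
# «the tempered Frobenioid `C` IS a Frobenioid» ([FrdI] Thm. 5.2 (ii)) — GAP A item GA-05 (D5 of GAP-SIZING-A.md)

S. Mochizuki, *The étale theta function …*, Publ. RIMS **45** (2009) [MochizukiEtTh2009], Def. 3.6 (ii) p.77 (PDF):
"Thus, the data `(D, Φ, B, B → Φ^gp)` determines a model Frobenioid `C` [cf. [FrdI], Theorem 5.2, (ii)]. We shall refer to a
Frobenioid `C` obtained in this way as a *tempered Frobenioid*"; S. Mochizuki, *The geometry of Frobenioids I*, Kyushu J. Math.
**62** (2008) [MochizukiFrdI2008], Thm. 5.2 (ii) p.101: "The category `C` is a Frobenioid [with respect to the functor `C → F_Φ`]";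
*Inter-universal Teichmüller Theory I* [Mochizuki2012], Ex. 3.2 (i) p.70 ("the hyperbolic curve `X̲̲_v` determines a tempered
Frobenioid … `ℱ̲_v` over the base category `𝒟_v`") [cite: MochizukiEtTh2009, Def 3.6 p.77].

GAP A of record G-L5-EX32I-1 (abc-iut cell), row GA-05 = D5 of `GAP-SIZING-A.md` 69de97346848d3e8 («the `hF` binder of
`BiratFromF`/`CFromF`/`TemperedThetaRestBirat` discharged AT the carrier»; risk locus R-hF «`hB₀inj`-type injectivity — low»);
ruled shape `plan/L5/GAP-A-SIGNATURES.md` v1 e3ccddf9b87597cf §5 (DOWNSTREAM TYPING RULE: stated over the BINDERS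
`(C : TemperedFrobenioid T' T.Dv VD)`, never over the term `temperedFrobenioid d T`).  Shared binders (§0):
`{p} [Fact p.Prime] (d : GaloisValDatum.{0} p) {P : Type} [Group P] [TopologicalSpace P] (T : BadLocalGroupDatum d.Gal P)` + ONE
instance the slot's `P := ↥(B x hx).H ≤ Π_{C_F}` (a subgroup of a profinite group) carries: `[IsTopologicalGroup P]` (used to know
that the monomorphisms of `CosetCat P` are isomorphisms, `CosetCat.isOfFSMType`; compare GA-02's `[SeparatelyContinuousMul P]`).

WHAT IS HERE (proof-only; no `def`, no instance, no notation):

* **`isFrobenioid_of_isMonoidOn_of_baseInj`** — over the EXACT §5 binders `{T'} {VD} (C : TemperedFrobenioid T' T.Dv VD)`: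
  `C → F_Φ` is a Frobenioid ([FrdI] Def. 1.3, via L1's PROVED Thm. 5.2 (ii) `ModelFrobenioid.isFrobenioid`) as soon as the two
  printed hypotheses of Thm. 5.2 hold — «`Φ` is a (divisorial) monoid on `D`» (`hΦ : IsMonoidOn C.divisorMonoid`; the
  OBJECTWISE divisoriality is automatic in the weak monoid vocabulary of `T'`) and «`B = B₀^Λ|_D ×_{(Φ^{ℝ-log})^gp} Φ^gp` is a
  (group-like) monoid on `D`», the latter reduced to the census-A9 predicate `TemperedFrobenioid.BaseInj C` («pull-backs of `B₀^Λ`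
  along the base are injective», = the memo's `hB₀inj`) because `𝒟_v̲ = CosetCat Π` is of FSM-type.
* **`isFrobenioid_of_baseInj`** — the same at the TREE category vocabulary `treeCatVocab T.Dv r s` (GA-04's `catVocab d T` is the
  instance `r = s = ⊤`), where `hΦ` is the field `isDivisorialOn`: modulo `hB` ONLY.
* **`isFrobenioid_realifiedOf`** — HYPOTHESIS-FREE at GA-03's engine-form realified data `realifiedOf d T A hZ` (★ p668558; GA-03's
  ruled `realified d T` is `realifiedOf d T (envelopeAction d T) (envelope_cuspLaws d T)` by `rfl`): `hB` is GA-02's PROVED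
  `divisorMonoidsOf_B₀_map_injective` (★ p667325; `baseInj_realifiedOf`).  Every tempered Frobenioid over `𝒟_v̲` on that data — in
  particular GA-12's `temperedFrobenioid d T` — IS a Frobenioid; D7 (GA-07) and C0 (GA-15) take `hF` from here BY NAME.
* **`isMonoidOn_ratFnFunctor_of_isFrobenioid`, `isFrobenioid_iff_isMonoidOn_ratFnFunctor`** — the converse at the tree
  vocabulary: a Frobenioid structure on `C → F_Φ` FORCES «`B` is a monoid on `D`» (total epimorphicity of `C` makes every pull-back
  `B(α)` injective: two morphisms `(1, id, 0, uᵢ)` equalised by `(1, α, 0, 1)` have `B(α) u₁ = B(α) u₂`).  So the input `hB` is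
  NOT idle, and the decoupling spec S0 (`ArithThetaTower.CarrierSpec`, GA-04 ★ p667989) is NOT an input of D5: its six fields
  (`base_eq`, `Φ_carrier`, `consts`, `aut_finite`, `theta`, `lZ`) are orthogonal to the two hypotheses of [FrdI] Thm. 5.2 (ii)
  (finding F-GA05-1, SIG-DELTA GA-05 on the board: the ruled token `isFrobenioid_of_carrierSpec (hC)` is realised as
  `isFrobenioid_of_baseInj (C) (hB)` / `isFrobenioid_realifiedOf`, no idle `hC` binder).

HONEST FRAMING: [FrdI] (2008) and [EtTh] (2009) are refereed pre-IUT material; these are kernel-checked statements about OUR typed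
objects (an UNDISPUTED construction around [IUTchIII] Cor. 3.12, which stays OPEN by charter, D-0045 — no side is taken on it or on any
author); typed ≠ inhabited (the carrier itself is GA-02/GA-03/GA-10/GA-12) ≠ proved-in-print; nothing here asserts the abc conjecture
proved or refuted; count-neutral; moratorium rq128 untouched.  No `sorry`, no new axiom, no instance/notation/attribute manipulation.
-/

noncomputable section

namespace Literature.AnabelianGeometry.EtaleTheta

namespace ArithThetaTower

open CategoryTheory Opposite Function Literature.AlgebraicGeometry.Frobenioids Literature.AnabelianGeometry.SemiGraphs
  Literature.IUT.HodgeTheaters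

variable {p : ℕ} [Fact p.Prime] (d : GaloisValDatum.{0} p) {P : Type} [Group P] [TopologicalSpace P] [IsTopologicalGroup P]
  (T : BadLocalGroupDatum d.Gal P)

/-! ## `𝒟_v̲ = CosetCat Π_v̲` is of FSM-type -/

/-- Over `𝒟_v̲ = CosetCat Π_v̲` every FSM-morphism (in particular every monomorphism) is an isomorphism ([FrdII] Ex. 1.3 (i):
"`𝓑(Π)⁰` … is of FSM-type"; tree `CosetCat.isOfFSMType`). [cite: MochizukiFrdII2008, Ex 1.3 (i) p.11] -/
theorem isIso_of_isFSM_Dv {U V : T.Dv} (α : V ⟶ U) (hα : IsFSM α) : IsIso α :=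
  (CosetCat.isOfFSMType (G := P)).isIso_of_isFSM α hα

/-! ## D5 over the §5 binders: «`C` is a Frobenioid» from «`Φ` a monoid on `D`» + `BaseInj` -/

section Binders

variable {T' : RealifiedDivisorMonoids (D₀ := T.Dv) treeMonoidVocabWeak.{0}} {VD : FrdICatStub.{0, 0, 0} T.Dv}
  (C : TemperedFrobenioid T' T.Dv VD)

/-- «`B = B₀^Λ|_D ×_{(Φ^{ℝ-log})^gp} Φ^gp` is a monoid on `𝒟_v̲`» ([FrdI] Def. 1.1 (ii): pull-backs characteristically injective,
bijective along FSM-morphisms) from «`Φ` is a monoid on `𝒟_v̲`» and `BaseInj` — the characteristic half is vacuous (`B(A)` is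
group-like, `RealifiedDivisorMonoids.isUnit_BΛ`) and the FSM half holds because `CosetCat Π` is of FSM-type.
[cite: MochizukiEtTh2009, Def 3.6 p.77] -/
theorem isMonoidOn_ratFnFunctor_of_isMonoidOn_of_baseInj (hΦ : IsMonoidOn C.divisorMonoid) (hB : C.BaseInj) :
    IsMonoidOn C.ratFnFunctor where
  isCharInjective {U V} α := by
    refine ⟨?_, ?_⟩
    · haveI : IsCancelMul (C.Φ.carrier (op U)) := C.isCancelMul_divisorMonoid_weak' (op U)
      haveI : IsCancelMul (C.Φ.carrier (op V)) := C.isCancelMul_divisorMonoid_weak' (op V)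
      exact C.ratFnPull_injective α.op (hB α) (gpMap_injective (C.Φ.pull α.op) (hΦ.isCharInjective α).1)
    · have hs : Subsingleton (Associates (C.ratFnFunctor.obj (op U))) :=
        subsingleton_associates_of_forall_isUnit fun m => C.ratFn_isUnit T'.isUnit_BΛ (op U) m
      exact fun a b _ => hs.elim a b
  bijective_of_isFSM α hα := by
    haveI := isIso_of_isFSM_Dv d T α hα
    exact C.ratFnPull_bijective_of_isIso α

/-- **D5 over the EXACT §5 binders `{T'} {VD} (C : TemperedFrobenioid T' T.Dv VD)`** — «`C → F_Φ` IS a Frobenioid» ([FrdI]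
Def. 1.3; L1's PROVED Thm. 5.2 (ii) `ModelFrobenioid.isFrobenioid`) from the two printed hypotheses of [FrdI] Thm. 5.2: «`Φ` is a
monoid on `D`» (`hΦ`; divisoriality OBJECTWISE is automatic for any `VD`, because `T'` lives in the weak monoid vocabulary:
`C.isPerfFactorial A : IsPerfFactorialCof (Φ(A))` ⇒ divisorial, tree `isDivisorial_divisorMonoid_treeMonoidVocabWeak`) and «`B` is
a monoid on `D`» in the reduced form `BaseInj` (census A9 = the memo's `hB₀inj`).  `D = 𝒟_v̲` is connected and totally epimorphic
(fields of `C`).  [cite: MochizukiEtTh2009, Def 3.6 p.77] -/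
theorem isFrobenioid_of_isMonoidOn_of_baseInj (hΦ : IsMonoidOn C.divisorMonoid) (hB : C.BaseInj) :
    PreFrobenioid.IsFrobenioid C.toElem :=
  haveI : IsConnected T.Dv := C.isConnected
  ModelFrobenioid.isFrobenioid hΦ (fun A => C.isDivisorial_divisorMonoid_treeMonoidVocabWeak A)
    (isMonoidOn_ratFnFunctor_of_isMonoidOn_of_baseInj d T C hΦ hB) (C.ratFnFunctor_isGroupLike T'.isUnit_BΛ)
    ((isGraphConnected_iff_isConnected (C := T.Dv)).2 inferInstance) C.isTotallyEpimorphic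

end Binders

/-! ## D5 at the tree category vocabulary: modulo `BaseInj` only, and the converse -/

section TreeVocab

variable {T' : RealifiedDivisorMonoids (D₀ := T.Dv) treeMonoidVocabWeak.{0}} {r s : (T.Dvᵒᵖ ⥤ CommMonCat.{0}) → Prop}
  (C : TemperedFrobenioid T' T.Dv (treeCatVocab T.Dv r s))

/-- «`B` is a monoid on `𝒟_v̲`» at the tree vocabulary, modulo `BaseInj` only. [cite: MochizukiEtTh2009, Def 3.6 p.77] -/
theorem isMonoidOn_ratFnFunctor_of_baseInj (hB : C.BaseInj) : IsMonoidOn C.ratFnFunctor :=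
  C.isMonoidOn_ratFnFunctor_of_baseInj' hB fun α hα => isIso_of_isFSM_Dv d T α hα

/-- **D5 at the tree vocabulary** (`treeCatVocab T.Dv r s`; GA-04's `catVocab d T` is `r = s = ⊤`): «`C → F_Φ` IS a Frobenioid»
modulo `BaseInj` ONLY (`hΦ` is the field `isDivisorialOn`; the FSM clause is `CosetCat.isOfFSMType`).
[cite: MochizukiEtTh2009, Def 3.6 p.77] -/
theorem isFrobenioid_of_baseInj (hB : C.BaseInj) : PreFrobenioid.IsFrobenioid C.toElem :=
  C.isFrobenioid_of_baseInj' hB fun α hα => isIso_of_isFSM_Dv d T α hα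

omit [IsTopologicalGroup P] in
/-- **The converse: a Frobenioid structure on `C → F_Φ` forces every pull-back `B(α)` of the rational-function monoid to be
injective.**  `C` is totally epimorphic (a standing hypothesis of [FrdI] Def. 1.3 via `IsPreFrobenioid`); for `α : V ⟶ U` in
`𝒟_v̲` and `u₁, u₂ ∈ B(U)` with `B(α) u₁ = B(α) u₂` (so `Div_B u₁ = Div_B u₂ =: η`, since `Φ(α)^gp` is injective) the two morphisms
`ψᵢ := (1, id_U, 0, uᵢ) : (U, η) → (U, 0)` are equalised by the morphism `φ := (1, α, 0, 1) : (V, α^*η) → (U, η)`, hence equal.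
[cite: MochizukiFrdI2008, Thm. 5.2(ii) p.101] -/
theorem ratFnPull_injective_of_isFrobenioid (hF : PreFrobenioid.IsFrobenioid C.toElem) {U V : T.Dv} (α : V ⟶ U) :
    Injective (C.ratFnPull α.op) := by
  intro u₁ u₂ h
  haveI := C.isCancelMul_divisorMonoid (unop (op U))
  haveI := C.isCancelMul_divisorMonoid (unop (op V))
  -- the divisor components agree, since `Φ(α)^gp` is injective
  have hΦinj : Injective (gpMap (C.Φ.pull α.op)) :=
    gpMap_injective (C.Φ.pull α.op) (C.isMonoidOn_divisorMonoid.isCharInjective α).1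
  have h2 : u₁.1.2 = u₂.1.2 := by
    have h' := congrArg Subtype.val h
    rw [TemperedFrobenioid.coe_ratFnPull, TemperedFrobenioid.coe_ratFnPull] at h'
    exact hΦinj (Prod.mk.inj h').2
  -- the objects `X = (U, η)`, `Y = (U, 0)`, `W = (V, α^* η)` of the model Frobenioid `C`
  let η : Algebra.GrothendieckGroup (C.Φ.carrier (op U)) := u₁.1.2
  let X : C.category := ⟨U, η⟩
  let Y : C.category := ⟨U, 1⟩
  let W : C.category := ⟨V, pullGp C.divisorMonoid α η⟩
  have hrel : ∀ u : C.ratFn (op U), u.1.2 = η →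
      X.cls ^ ((1 : ℕ+) : ℕ) * Algebra.GrothendieckGroup.of (1 : C.divisorMonoid.obj (op U)) =
        pullGp C.divisorMonoid (𝟙 U) Y.cls * divB C.divisorMonoid C.ratFnFunctor C.divBNatTrans (op U) u := by
    intro u hu
    rw [PNat.one_coe, pow_one, map_one, mul_one, map_one, one_mul]
    exact hu.symm
  let ψ₁ : X ⟶ Y := ModelFrobenioid.mkHom X Y 1 (𝟙 U) 1 u₁ (hrel u₁ rfl)
  let ψ₂ : X ⟶ Y := ModelFrobenioid.mkHom X Y 1 (𝟙 U) 1 u₂ (hrel u₂ h2.symm)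
  let φ : W ⟶ X := ModelFrobenioid.mkHom W X 1 α 1 1 (by
    rw [PNat.one_coe, pow_one, map_one, mul_one, map_one, mul_one])
  have hcomp : φ ≫ ψ₁ = φ ≫ ψ₂ := by
    refine ModelFrobenioid.hom_ext rfl rfl rfl ?_
    change (C.ratFnFunctor.map α.op).hom u₁ * 1 ^ ((1 : ℕ+) : ℕ) = (C.ratFnFunctor.map α.op).hom u₂ * 1 ^ ((1 : ℕ+) : ℕ)
    rw [one_pow, mul_one, mul_one]
    exact h
  haveI : Epi φ := hF.isPreFrobenioid.isTotallyEpimorphic.epi φ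
  have hψ : ψ₁ = ψ₂ := (cancel_epi φ).1 hcomp
  exact congrArg ModelFrobenioid.unit hψ

/-- **«`B` is a monoid on `𝒟_v̲`» is NECESSARY for D5** (at the tree vocabulary): it follows from «`C → F_Φ` is a Frobenioid».
[cite: MochizukiFrdI2008, Thm. 5.2(ii) p.101] -/
theorem isMonoidOn_ratFnFunctor_of_isFrobenioid (hF : PreFrobenioid.IsFrobenioid C.toElem) : IsMonoidOn C.ratFnFunctor where
  isCharInjective {U V} α := by
    refine ⟨ratFnPull_injective_of_isFrobenioid d T C hF α, ?_⟩
    have hs : Subsingleton (Associates (C.ratFnFunctor.obj (op U))) :=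
      subsingleton_associates_of_forall_isUnit fun m => C.ratFn_isUnit T'.isUnit_BΛ (op U) m
    exact fun a b _ => hs.elim a b
  bijective_of_isFSM α hα := by
    haveI := isIso_of_isFSM_Dv d T α hα
    exact C.ratFnPull_bijective_of_isIso α

/-- **CRITERION (D5 ⟺ «`B` a monoid on `𝒟_v̲`»)** at the tree vocabulary over `𝒟_v̲ = CosetCat Π_v̲`: the tempered Frobenioid
`C → F_Φ` is a Frobenioid IFF its rational-function monoid `B` is a monoid on `D` in the sense of [FrdI] Def. 1.1 (ii) — exactly
the hypothesis [FrdI] Thm. 5.2 presupposes.  [cite: MochizukiFrdI2008, Thm. 5.2(ii) p.101] -/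
theorem isFrobenioid_iff_isMonoidOn_ratFnFunctor : PreFrobenioid.IsFrobenioid C.toElem ↔ IsMonoidOn C.ratFnFunctor :=
  ⟨isMonoidOn_ratFnFunctor_of_isFrobenioid d T C, C.isFrobenioid_treeCatVocab_of_isMonoidOn⟩

end TreeVocab

/-! ## D5 at GA-03's engine-form realified data `realifiedOf d T A hZ`: hypothesis-free -/

section RealifiedOf

variable {Z : LogDivisorModel.{0}} (A : Z.GaloisAction P) (hZ : Z.CuspLaws)

omit [IsTopologicalGroup P] in
/-- `BaseInj` HOLDS for every tempered Frobenioid (any category vocabulary) over GA-03's realified data `realifiedOf d T A hZ`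
(`B₀^Λ = B₀ = (Ω^{aug U})ˣ × Mero(Z)^U`): GA-02's `divisorMonoidsOf_B₀_map_injective` (field inclusions × inclusions of
invariants) — the memo's `hB₀inj`, discharged. [cite: MochizukiEtTh2009, Def 3.3 (iii) p.73] -/
theorem baseInj_realifiedOf {VD : FrdICatStub.{0, 0, 0} T.Dv} (C : TemperedFrobenioid (realifiedOf d T A hZ) T.Dv VD) :
    C.BaseInj :=
  TemperedFrobenioid.BaseInj.of_hBinj C fun g => divisorMonoidsOf_B₀_map_injective d T A hZ g

/-- **D5, ENGINE FORM, HYPOTHESIS-FREE**: every tempered Frobenioid over `𝒟_v̲ = CosetCat Π_v̲` (tree vocabulary `treeCatVocab T.Dv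
r s`, e.g. GA-04's `catVocab d T`) on GA-03's realified data `realifiedOf d T A hZ` — in particular GA-12's `temperedFrobenioid d T`
(`realified d T = realifiedOf d T (envelopeAction d T) (envelope_cuspLaws d T)` by `rfl`) — IS a Frobenioid ([FrdI] Def. 1.3 via
Thm. 5.2 (ii)).  This is the `hF` binder of `TemperedThetaRestBirat`/`BiratFromF`/`CFromF` at the GAP-A carrier (D7, C0).
[cite: MochizukiEtTh2009, Def 3.6 p.77] -/
theorem isFrobenioid_realifiedOf {r s : (T.Dvᵒᵖ ⥤ CommMonCat.{0}) → Prop}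
    (C : TemperedFrobenioid (realifiedOf d T A hZ) T.Dv (treeCatVocab T.Dv r s)) : PreFrobenioid.IsFrobenioid C.toElem :=
  isFrobenioid_of_baseInj d T C (baseInj_realifiedOf d T A hZ C)

/-- The same over ANY category vocabulary `VD`, modulo «`Φ` is a monoid on `𝒟_v̲`» only. [cite: MochizukiEtTh2009, Def 3.6 p.77] -/
theorem isFrobenioid_realifiedOf_of_isMonoidOn {VD : FrdICatStub.{0, 0, 0} T.Dv}
    (C : TemperedFrobenioid (realifiedOf d T A hZ) T.Dv VD) (hΦ : IsMonoidOn C.divisorMonoid) :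
    PreFrobenioid.IsFrobenioid C.toElem :=
  isFrobenioid_of_isMonoidOn_of_baseInj d T C hΦ (baseInj_realifiedOf d T A hZ C)

/-- «`B` is a monoid on `𝒟_v̲`» at GA-03's realified data, hypothesis-free (tree vocabulary). [cite: MochizukiEtTh2009, Def 3.6 p.77] -/
theorem isMonoidOn_ratFnFunctor_realifiedOf {r s : (T.Dvᵒᵖ ⥤ CommMonCat.{0}) → Prop}
    (C : TemperedFrobenioid (realifiedOf d T A hZ) T.Dv (treeCatVocab T.Dv r s)) : IsMonoidOn C.ratFnFunctor :=
  isMonoidOn_ratFnFunctor_of_baseInj d T C (baseInj_realifiedOf d T A hZ C)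

end RealifiedOf

end ArithThetaTower

end Literature.AnabelianGeometry.EtaleTheta

end
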